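import Literature.Analysis.FluidPDE.LadyzhenskayaPointwise
import HarnessLib

/-!
# Ladyzhenskaya's weighted enstrophy estimate, II: `∫ (ω_θ/r)²(t) ≤ ∫ (ω_θ/r)²(0)`

Analysis/FluidPDE proof file (all results proved, no definitions) on the decomposition path of
the named fact `Literature.Analysis.FluidPDE.axisymmetricNoSwirl_enstrophy_apriori`
(Lemarié-Rieusset 2016, Thm. 10.4). It completes Ladyzhenskaya's key estimate (10.27)
(with `f = 0`): for a classical solution of the unforced Navier–Stokes system on the closed slab
`[0, T] × ℝ³` which is axisymmetric without swirl at all times, the scalar `f = ω_θ/r`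
(`curl u(t) = f(t) · J`, the smooth Hadamard quotient of `AxisymNoSwirlVorticity`) satisfies
`∫ f(t)² dx ≤ ∫ f(0)² dx` for all `t ∈ [0, T]` (`ladyzhenskaya_weighted_estimate`), i.e.
`∫ |ω(t)|² r⁻² dx ≤ ∫ |ω₀|² r⁻² dx ≤ ‖ω₀‖²_{Ḣ¹}`.

Steps (the fixed-time inequality is `LadyzhenskayaPointwise.ladyzhenskaya_slice_le`):

* `localisedEnstrophy_le_add_mul` — a bounded production against a static continuous compactly
  supported weight gives linear growth of the localised enstrophy `½∫|ω|²φ` (continuity on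
  `[0, T]`, derivative at interior times from `TaoLocalisedEnstrophy`, mean value inequality);
* `norm_sq_mul_axisWeight_eq` — `|ω|² η_{ε,R} = f² α_ε χ_R`;
* `ladyzhenskaya_weighted_estimate_eps_R` — `∫ f(t)² α_ε χ_R ≤ ∫ f(0)² + 2t (c₁ ε R + c₂ F⋆/R)`;
* `tendsto_integral_mul_axisCutoff_mul`, `tendsto_integral_mul_sqBallCutoff` — removal of the
  cutoffs by dominated convergence (the axis is Lebesgue-null);
* `ladyzhenskaya_weighted_estimate` — `ε → 0`, then `R → ∞`.

The uniform bounds `|f| ≤ F`, `‖Df‖ ≤ G`, `|u| ≤ V`, `∫ f(t)² ≤ F⋆` assumed here hold in Tao's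
smooth class (all Sobolev norms bounded on the closed slab); they enter only the error terms.
The book's extra regularisation `r^η`, `η → 0` (needed there because only
`ω ∈ L^∞H¹ ∩ L²H²` is known) is not needed for smooth bounded `f`.

## References

* P. G. Lemarié-Rieusset, *The Navier–Stokes Problem in the 21st Century*, CRC Press (2016),
  §10.3, proof of Thm. 10.4, (10.25)–(10.27), pp. 286–288. [LemarieRieusset2016]
* O. A. Ladyzhenskaya, Zap. Naučn. Sem. LOMI 7 (1968) 155–177 (the book's [295]);
  M. R. Ukhovskii, V. I. Yudovich, J. Appl. Math. Mech. 32 (1968) 52–69 ([486]);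
  S. Leonardi, J. Málek, J. Nečas, M. Pokorný, Z. Anal. Anwendungen 18 (1999) 639–649 ([326]).
-/

noncomputable section

open Set Function Filter MeasureTheory Metric Topology
open scoped RealInnerProductSpace ENNReal NNReal Topology

namespace Literature.Analysis.FluidPDE

/-! ### Time integration of a bounded production against a static weight -/

section Static

variable {T : ℝ} {w : ℝ → EuclideanSpace ℝ (Fin 3) → EuclideanSpace ℝ (Fin 3)}

/-- The localised enstrophy `½∫|curl w(t)|²φ` against a continuous compactly supported static
weight is continuous on the closed slab. [folklore] -/
theorem continuousOn_localisedEnstrophy_static (hT : 0 < T) (hw : IsSmoothSpaceTimeOn (Icc 0 T) w)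
    {φ : EuclideanSpace ℝ (Fin 3) → ℝ} (hφ : Continuous φ) (hφc : HasCompactSupport φ) :
    ContinuousOn (fun t => localisedEnstrophy φ (w t)) (Icc 0 T) := by
  have hK : IsCompact (tsupport φ) := hφc
  have hc : ContinuousOn (uncurry fun (t : ℝ) (x : EuclideanSpace ℝ (Fin 3)) =>
      ‖curl (w t) x‖ ^ 2 * φ x) (Icc 0 T ×ˢ univ) :=
    ((continuousOn_curl_slab hT hw).norm.pow 2).mul (hφ.comp continuous_snd).continuousOn
  have hzero : ∀ (t : ℝ) (x : EuclideanSpace ℝ (Fin 3)), t ∈ Icc 0 T → x ∉ tsupport φ →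
      ‖curl (w t) x‖ ^ 2 * φ x = 0 := fun t x _ hx => by
    rw [image_eq_zero_of_notMem_tsupport hx, mul_zero]
  have h := continuousOn_integral_of_compact_support (μ := volume) hK hc hzero
  simp only [localisedEnstrophy_def]
  exact continuousOn_const.mul h

/-- **Linear growth from a bounded production.** If the enstrophy production of a jointly smooth
field against a continuous compactly supported static weight `φ` is bounded by `B` at all
interior times, then `½∫|ω(t)|²φ ≤ ½∫|ω(0)|²φ + B t` on `[0, T]` (the localised enstrophy is
continuous on `[0, T]`, differentiable on `(0, T)` with derivative the production; mean value
inequality). [folklore] -/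
theorem localisedEnstrophy_le_add_mul (hT : 0 < T) (hw : IsSmoothSpaceTimeOn (Icc 0 T) w)
    {φ : EuclideanSpace ℝ (Fin 3) → ℝ} (hφ : Continuous φ) (hφc : HasCompactSupport φ) {B : ℝ}
    (hB : ∀ t ∈ Ioo 0 T, ∫ x, enstrophyProduction T w t x * φ x ≤ B) :
    ∀ t ∈ Icc 0 T, localisedEnstrophy φ (w t) ≤ localisedEnstrophy φ (w 0) + B * t := by
  have hK : IsCompact (tsupport φ) := hφc
  have hsupp : ∀ x ∉ tsupport φ, φ x = 0 := fun x hx => image_eq_zero_of_notMem_tsupport hx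
  have hWc := continuousOn_localisedEnstrophy_static hT hw hφ hφc
  have hderiv : ∀ t ∈ Ioo 0 T, HasDerivAt (fun s => localisedEnstrophy φ (w s))
      (∫ x, enstrophyProduction T w t x * φ x) t := fun t ht =>
    hasDerivAt_localisedEnstrophy_frozen hT hw hφ hK hsupp ht
  have hWd : DifferentiableOn ℝ (fun s => localisedEnstrophy φ (w s)) (interior (Icc 0 T)) := by
    rw [interior_Icc]
    exact fun t ht => (hderiv t ht).differentiableAt.differentiableWithinAt
  have hle : ∀ t ∈ interior (Icc 0 T), deriv (fun s => localisedEnstrophy φ (w s)) t ≤ B := by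
    rw [interior_Icc]
    intro t ht
    rw [(hderiv t ht).deriv]
    exact hB t ht
  intro t ht
  have h := (convex_Icc 0 T).image_sub_le_mul_sub_of_deriv_le hWc hWd hle 0
    ⟨le_rfl, hT.le⟩ t ht ht.1
  rw [sub_zero] at h
  linarith

end Static

/-! ### The weighted enstrophy is `½∫ f² α_ε χ_R` -/

section Identification

variable {f : EuclideanSpace ℝ (Fin 3) → ℝ}
  {ω : EuclideanSpace ℝ (Fin 3) → EuclideanSpace ℝ (Fin 3)}

/-- For `ω = f · J` and the weight `η_{ε,R} = α_ε χ_R/ρ`: `|ω|² η_{ε,R} = f² α_ε χ_R`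
pointwise (off the axis `|ω|² = f²ρ`; on the axis both sides vanish). [folklore] -/
theorem norm_sq_mul_axisWeight_eq (hω : ω = fun y => f y • rotGen y) {ε : ℝ} (hε : 0 < ε)
    (R : ℝ) (x : EuclideanSpace ℝ (Fin 3)) :
    ‖ω x‖ ^ 2 * (Real.smoothTransition ((x 0 ^ 2 + x 1 ^ 2) / ε ^ 2 - 1) *
        Real.smoothTransition (2 - ‖x‖ ^ 2 / R ^ 2) ^ 2 / (x 0 ^ 2 + x 1 ^ 2)) =
      f x ^ 2 * (Real.smoothTransition ((x 0 ^ 2 + x 1 ^ 2) / ε ^ 2 - 1) *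
        Real.smoothTransition (2 - ‖x‖ ^ 2 / R ^ 2) ^ 2) := by
  rw [norm_sq_of_eq_smul_rotGen hω x]
  by_cases hρ : x 0 ^ 2 + x 1 ^ 2 = 0
  · rw [axisCutoff_eq_zero hε (by rw [hρ]; positivity)]
    simp
  · field_simp

end Identification

/-! ### Ladyzhenskaya's estimate -/

section Main

variable {T ν : ℝ} {u : ℝ → EuclideanSpace ℝ (Fin 3) → EuclideanSpace ℝ (Fin 3)}
  {p : ℝ → EuclideanSpace ℝ (Fin 3) → ℝ}

/-- **Step 1: the weighted estimate at fixed `ε`, `R`.** Under the hypotheses of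
`ladyzhenskaya_weighted_estimate`, for `0 < ε`, `1 ≤ R` and `t ∈ [0, T]`:
`∫ f(t)² α_ε χ_R ≤ ∫ f(0)² + 2t (64 D C₁ ε R + C₂ F⋆ / R)` with `C₁ = 3νFG + F²V/2`,
`C₂ = 144νD² + 4νD + 2√2DV` (time integration of `ladyzhenskaya_slice_le`).
[cite: LemarieRieusset2016, §10.3 pp. 287–288] -/
theorem ladyzhenskaya_weighted_estimate_eps_R (hT : 0 < T) (hν : 0 ≤ ν)
    (hsol : IsClassicalNSSolutionOn (Icc 0 T) ν 0 u p)
    (hax : ∀ t ∈ Icc 0 T, IsAxisymmetric (u t)) (hsw : ∀ t ∈ Icc 0 T, HasNoSwirl (u t))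
    {D : ℝ} (hD : ∀ s, |deriv Real.smoothTransition s| ≤ D)
    {F G V Fstar : ℝ}
    (hF : ∀ t ∈ Icc 0 T, ∀ x, |hadamardQuotFst (fun y => curl (u t) y 1) x| ≤ F)
    (hG : ∀ t ∈ Icc 0 T, ∀ x, ‖fderiv ℝ (hadamardQuotFst (fun y => curl (u t) y 1)) x‖ ≤ G)
    (hV : ∀ t ∈ Icc 0 T, ∀ x, ‖u t x‖ ≤ V)
    (hint : ∀ t ∈ Icc 0 T, Integrable (fun x => hadamardQuotFst (fun y => curl (u t) y 1) x ^ 2))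
    (hFstar : ∀ t ∈ Icc 0 T, ∫ x, hadamardQuotFst (fun y => curl (u t) y 1) x ^ 2 ≤ Fstar)
    {ε R : ℝ} (hε : 0 < ε) (hR : 1 ≤ R) {t : ℝ} (ht : t ∈ Icc 0 T) :
    ∫ x, hadamardQuotFst (fun y => curl (u t) y 1) x ^ 2 *
        (Real.smoothTransition ((x 0 ^ 2 + x 1 ^ 2) / ε ^ 2 - 1) *
          Real.smoothTransition (2 - ‖x‖ ^ 2 / R ^ 2) ^ 2) ≤
      (∫ x, hadamardQuotFst (fun y => curl (u 0) y 1) x ^ 2) +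
        2 * t * (64 * D * (3 * ν * F * G + F ^ 2 * V / 2) * ε * R +
          (144 * ν * D ^ 2 + 4 * ν * D + 2 * Real.sqrt 2 * D * V) / R * Fstar) := by
  set α : EuclideanSpace ℝ (Fin 3) → ℝ := fun y =>
    Real.smoothTransition ((y 0 ^ 2 + y 1 ^ 2) / ε ^ 2 - 1) with hαdef
  set χ : EuclideanSpace ℝ (Fin 3) → ℝ := fun y =>
    Real.smoothTransition (2 - ‖y‖ ^ 2 / R ^ 2) ^ 2 with hχdef
  set η : EuclideanSpace ℝ (Fin 3) → ℝ := fun y => α y * χ y / (y 0 ^ 2 + y 1 ^ 2) with hηdef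
  have hR0 : 0 < R := by linarith
  have hD0 : 0 ≤ D := (abs_nonneg _).trans (hD 0)
  have h0T : (0 : ℝ) ∈ Icc 0 T := ⟨le_rfl, hT.le⟩
  have hV0 : 0 ≤ V := (norm_nonneg _).trans (hV 0 h0T 0)
  have hC₂0 : 0 ≤ (144 * ν * D ^ 2 + 4 * ν * D + 2 * Real.sqrt 2 * D * V) / R := by positivity
  -- the weight
  have hηs : ContDiff ℝ 1 η := contDiff_axisWeight hε R
  have hηc : HasCompactSupport η := hasCompactSupport_axisWeight ε hR0
  have hηcont : Continuous η := hηs.continuous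
  -- the production bound at interior times
  set B : ℝ := 64 * D * (3 * ν * F * G + F ^ 2 * V / 2) * ε * R +
    (144 * ν * D ^ 2 + 4 * ν * D + 2 * Real.sqrt 2 * D * V) / R * Fstar with hBdef
  have hB : ∀ s ∈ Ioo 0 T, ∫ x, enstrophyProduction T u s x * η x ≤ B := by
    intro s hs
    have hs' : s ∈ Icc 0 T := Ioo_subset_Icc_self hs
    have h := ladyzhenskaya_slice_le hT hν hsol hs' (hax s hs') (hsw s hs') hD hε hR (hF s hs')
      (hG s hs') (hV s hs') (hint s hs')
    refine h.trans ?_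
    rw [hBdef]
    gcongr
    exact hFstar s hs'
  -- time integration
  have hgrow := localisedEnstrophy_le_add_mul hT hsol.smooth_velocity hηcont hηc hB t ht
  -- identification of the weighted enstrophies
  have hid : ∀ s ∈ Icc 0 T, localisedEnstrophy η (u s) =
      1 / 2 * ∫ x, hadamardQuotFst (fun y => curl (u s) y 1) x ^ 2 * (α x * χ x) := by
    intro s hs
    have hu2 : ContDiff ℝ 2 (u s) := (hsol.contDiff_velocity hs).of_le (by norm_cast)
    have hω : curl (u s) = fun y => hadamardQuotFst (fun y => curl (u s) y 1) y • rotGen y :=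
      funext fun y => curl_eq_hadamardQuotFst_smul_rotGen (hax s hs) (hsw s hs) hu2 y
    rw [localisedEnstrophy_def]
    congr 1
    refine integral_congr_ae (Eventually.of_forall fun x => ?_)
    exact norm_sq_mul_axisWeight_eq hω hε R x
  rw [hid t ht, hid 0 h0T] at hgrow
  -- the initial weighted integral is at most the unweighted one
  have hw01 : ∀ x, 0 ≤ α x * χ x ∧ α x * χ x ≤ 1 := fun x =>
    ⟨mul_nonneg (axisCutoff_nonneg ε x) (sqBallCutoff_nonneg R x),
      mul_le_one₀ (axisCutoff_le_one ε x) (sqBallCutoff_nonneg R x) (sqBallCutoff_le_one R x)⟩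
  have hwc : Continuous fun x => α x * χ x :=
    (contDiff_axisCutoff ε (n := 0)).continuous.mul (contDiff_sqBallCutoff R (n := 0)).continuous
  have hint0w : Integrable fun x => hadamardQuotFst (fun y => curl (u 0) y 1) x ^ 2 * (α x * χ x) :=
    (hint 0 h0T).mul_bdd hwc.aestronglyMeasurable (ae_of_all _ fun x => by
      rw [Real.norm_eq_abs, abs_of_nonneg (hw01 x).1]; exact (hw01 x).2)
  have h0le : ∫ x, hadamardQuotFst (fun y => curl (u 0) y 1) x ^ 2 * (α x * χ x) ≤
      ∫ x, hadamardQuotFst (fun y => curl (u 0) y 1) x ^ 2 :=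
    integral_mono hint0w (hint 0 h0T) fun x => by
      have := (hw01 x).2
      have h0 : 0 ≤ hadamardQuotFst (fun y => curl (u 0) y 1) x ^ 2 := sq_nonneg _
      nlinarith
  linarith

/-! #### Removing the cutoffs -/

/-- **Removing the axis cutoff** (`ε → 0` along `ε = 1/(n+1)`): for integrable `g`,
`∫ g α_ε χ_R → ∫ g χ_R` (dominated convergence: `0 ≤ α_ε χ_R ≤ 1`, and `α_ε → 1` off the
Lebesgue-null axis). This is the passage "letting `ε` go to `0`" of Lemarié-Rieusset 2016,
p. 288. [cite: LemarieRieusset2016, §10.3 p. 288] -/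
theorem tendsto_integral_mul_axisCutoff_mul {g : EuclideanSpace ℝ (Fin 3) → ℝ} (hg : Integrable g)
    (R : ℝ) :
    Tendsto (fun n : ℕ => ∫ x, g x *
        (Real.smoothTransition ((x 0 ^ 2 + x 1 ^ 2) / ((1 : ℝ) / (n + 1)) ^ 2 - 1) *
          Real.smoothTransition (2 - ‖x‖ ^ 2 / R ^ 2) ^ 2)) atTop
      (𝓝 (∫ x, g x * Real.smoothTransition (2 - ‖x‖ ^ 2 / R ^ 2) ^ 2)) := by
  refine tendsto_integral_of_dominated_convergence (fun x => ‖g x‖) (fun n => ?_) hg.norm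
    (fun n => ae_of_all _ fun x => ?_) ?_
  · exact (hg.aestronglyMeasurable.mul
      (((contDiff_axisCutoff _ (n := 0)).continuous.mul
        (contDiff_sqBallCutoff R (n := 0)).continuous).aestronglyMeasurable))
  · rw [norm_mul]
    refine mul_le_of_le_one_right (norm_nonneg _) ?_
    rw [Real.norm_eq_abs,
      abs_of_nonneg (mul_nonneg (axisCutoff_nonneg _ x) (sqBallCutoff_nonneg R x))]
    exact mul_le_one₀ (axisCutoff_le_one _ x) (sqBallCutoff_nonneg R x) (sqBallCutoff_le_one R x)
  · have hae : ∀ᵐ x : EuclideanSpace ℝ (Fin 3), x 0 ^ 2 + x 1 ^ 2 ≠ 0 := by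
      rw [ae_iff]
      simpa using volume_axis_eq_zero
    filter_upwards [hae] with x hx
    refine (tendsto_const_nhds
      (x := g x * Real.smoothTransition (2 - ‖x‖ ^ 2 / R ^ 2) ^ 2)).congr' ?_
    filter_upwards [eventually_axisCutoff_eq_one hx] with n hn
    rw [hn, one_mul]

/-- **Removing the ball cutoff** (`R → ∞` along `R = m+1`): for integrable `g`, `∫ g χ_R → ∫ g`
(dominated convergence: `0 ≤ χ_R ≤ 1`, `χ_R → 1` pointwise). [folklore] -/
theorem tendsto_integral_mul_sqBallCutoff {g : EuclideanSpace ℝ (Fin 3) → ℝ} (hg : Integrable g) :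
    Tendsto (fun m : ℕ => ∫ x, g x * Real.smoothTransition (2 - ‖x‖ ^ 2 / ((m : ℝ) + 1) ^ 2) ^ 2)
      atTop (𝓝 (∫ x, g x)) := by
  refine tendsto_integral_of_dominated_convergence (fun x => ‖g x‖) (fun m => ?_) hg.norm
    (fun m => ae_of_all _ fun x => ?_) (ae_of_all _ fun x => ?_)
  · exact hg.aestronglyMeasurable.mul
      (contDiff_sqBallCutoff _ (n := 0)).continuous.aestronglyMeasurable
  · rw [norm_mul]
    refine mul_le_of_le_one_right (norm_nonneg _) ?_
    rw [Real.norm_eq_abs, abs_of_nonneg (sqBallCutoff_nonneg _ x)]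
    exact sqBallCutoff_le_one _ x
  · refine (tendsto_const_nhds (x := g x)).congr' ?_
    filter_upwards [eventually_sqBallCutoff_eq_one x] with m hm
    rw [hm, mul_one]

/-- **Ladyzhenskaya's key estimate** (Lemarié-Rieusset 2016, (10.27) with `f = 0`:
`∫ |ω(t)|² r⁻² dx ≤ ∫ |ω₀|² r⁻² dx (≤ ‖ω₀‖²_{Ḣ¹})`; after Ladyzhenskaya 1968,
Ukhovskii–Yudovich 1968, Leonardi–Málek–Nečas–Pokorný 1999). Let `(u, p)` be a classical
solution of the unforced Navier–Stokes system on `[0, T] × ℝ³` which is axisymmetric without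
swirl at every time, and let `f(t) = ω_θ(t)/r` be the smooth Hadamard quotient of
`AxisymNoSwirlVorticity` (`curl u(t) = f(t) · J`). Assume the uniform bounds `|f| ≤ F`,
`‖Df‖ ≤ G`, `|u| ≤ V` on the slab and `f(t) ∈ L²` with `∫ f(t)² ≤ F⋆` (all available in Tao's
class). Then `∫ f(t)² ≤ ∫ f(0)²` for every `t ∈ [0, T]`.
Proof: `ladyzhenskaya_weighted_estimate_eps_R`, then `ε → 0` and `R → ∞` by dominated
convergence (the constants `F, G, V, F⋆` only enter the vanishing error terms).
[cite: LemarieRieusset2016, §10.3 Thm. 10.4 proof, (10.25)–(10.27) pp. 286–288] -/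
theorem ladyzhenskaya_weighted_estimate (hT : 0 < T) (hν : 0 ≤ ν)
    (hsol : IsClassicalNSSolutionOn (Icc 0 T) ν 0 u p)
    (hax : ∀ t ∈ Icc 0 T, IsAxisymmetric (u t)) (hsw : ∀ t ∈ Icc 0 T, HasNoSwirl (u t))
    {F G V Fstar : ℝ}
    (hF : ∀ t ∈ Icc 0 T, ∀ x, |hadamardQuotFst (fun y => curl (u t) y 1) x| ≤ F)
    (hG : ∀ t ∈ Icc 0 T, ∀ x, ‖fderiv ℝ (hadamardQuotFst (fun y => curl (u t) y 1)) x‖ ≤ G)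
    (hV : ∀ t ∈ Icc 0 T, ∀ x, ‖u t x‖ ≤ V)
    (hint : ∀ t ∈ Icc 0 T, Integrable (fun x => hadamardQuotFst (fun y => curl (u t) y 1) x ^ 2))
    (hFstar : ∀ t ∈ Icc 0 T, ∫ x, hadamardQuotFst (fun y => curl (u t) y 1) x ^ 2 ≤ Fstar) :
    ∀ t ∈ Icc 0 T, ∫ x, hadamardQuotFst (fun y => curl (u t) y 1) x ^ 2 ≤
      ∫ x, hadamardQuotFst (fun y => curl (u 0) y 1) x ^ 2 := by
  intro t ht
  obtain ⟨D, hD0, hD⟩ := Calculus.exists_bound_deriv_smoothTransition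
  set g : EuclideanSpace ℝ (Fin 3) → ℝ := fun x => hadamardQuotFst (fun y => curl (u t) y 1) x ^ 2
    with hgdef
  set I0 : ℝ := ∫ x, hadamardQuotFst (fun y => curl (u 0) y 1) x ^ 2 with hI0
  set C₁ : ℝ := 3 * ν * F * G + F ^ 2 * V / 2 with hC₁
  set C₂ : ℝ := 144 * ν * D ^ 2 + 4 * ν * D + 2 * Real.sqrt 2 * D * V with hC₂
  have hg : Integrable g := hint t ht
  -- Step 2: `ε → 0` at fixed `R = m + 1`
  have hR : ∀ m : ℕ, ∫ x, g x * Real.smoothTransition (2 - ‖x‖ ^ 2 / ((m : ℝ) + 1) ^ 2) ^ 2 ≤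
      I0 + 2 * t * (C₂ / ((m : ℝ) + 1) * Fstar) := by
    intro m
    have hR1 : (1 : ℝ) ≤ (m : ℝ) + 1 := by
      have : (0 : ℝ) ≤ m := Nat.cast_nonneg m
      linarith
    have hstep : ∀ n : ℕ, ∫ x, g x *
        (Real.smoothTransition ((x 0 ^ 2 + x 1 ^ 2) / ((1 : ℝ) / (n + 1)) ^ 2 - 1) *
          Real.smoothTransition (2 - ‖x‖ ^ 2 / ((m : ℝ) + 1) ^ 2) ^ 2) ≤
        I0 + 2 * t * (64 * D * C₁ * ((1 : ℝ) / (n + 1)) * ((m : ℝ) + 1) +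
          C₂ / ((m : ℝ) + 1) * Fstar) := fun n =>
      ladyzhenskaya_weighted_estimate_eps_R hT hν hsol hax hsw hD hF hG hV hint hFstar
        (ε := (1 : ℝ) / (n + 1)) (R := (m : ℝ) + 1) (by positivity) hR1 ht
    have hlim1 := tendsto_integral_mul_axisCutoff_mul hg ((m : ℝ) + 1)
    have hlim2 : Tendsto (fun n : ℕ => I0 + 2 * t * (64 * D * C₁ * ((1 : ℝ) / (n + 1)) *
        ((m : ℝ) + 1) + C₂ / ((m : ℝ) + 1) * Fstar)) atTop
        (𝓝 (I0 + 2 * t * (64 * D * C₁ * 0 * ((m : ℝ) + 1) + C₂ / ((m : ℝ) + 1) * Fstar))) := by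
      have h0 : Tendsto (fun n : ℕ => (1 : ℝ) / ((n : ℝ) + 1)) atTop (𝓝 0) :=
        tendsto_one_div_add_atTop_nhds_zero_nat
      exact tendsto_const_nhds.add (tendsto_const_nhds.mul
        (((tendsto_const_nhds.mul h0).mul tendsto_const_nhds).add tendsto_const_nhds))
    have := le_of_tendsto_of_tendsto' hlim1 hlim2 hstep
    simpa using this
  -- Step 3: `R → ∞`
  have hlim3 := tendsto_integral_mul_sqBallCutoff hg
  have hlim4 : Tendsto (fun m : ℕ => I0 + 2 * t * (C₂ / ((m : ℝ) + 1) * Fstar)) atTop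
      (𝓝 (I0 + 2 * t * (C₂ * 0 * Fstar))) := by
    have h0 : Tendsto (fun m : ℕ => (1 : ℝ) / ((m : ℝ) + 1)) atTop (𝓝 0) :=
      tendsto_one_div_add_atTop_nhds_zero_nat
    have h1 : Tendsto (fun m : ℕ => C₂ / ((m : ℝ) + 1)) atTop (𝓝 (C₂ * 0)) := by
      have := (tendsto_const_nhds (x := C₂)).mul h0
      refine this.congr fun m => ?_
      ring
    exact tendsto_const_nhds.add (tendsto_const_nhds.mul (h1.mul tendsto_const_nhds))
  have := le_of_tendsto_of_tendsto' hlim3 hlim4 hR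
  simpa using this

end Main

end Literature.Analysis.FluidPDE

end
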